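import Summits.AnomalousDissipation.AnomalousDissipation.Theorems.BaireTransferDenseLoudDesignerForcesErgodicLine
import Literature.Analysis.FluidPDE.TorusLinearisedNSGevreySmoothing

/-!
# Gevrey smoothing of the linearised flow along a Gevrey background on `T³` (tools stub T1g
# `stub_linearisedGevreySmoothingTools`, block N-R, line `ergodic-budget-selection-closing`,
# crux `BaireTransfer.DenseLoudDesignerForces`, stmt-AnomalousDissipation-1143)

Summit-side specialisation to `T³ = UnitAddTorus (Fin 3)` of the Literature theorem
`Torus.linearisedNS_gevrey_of_gevreyBound` (`Literature/Analysis/FluidPDE/TorusLinearisedNSGevreySmoothing.lean`,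
over the linear Gevrey balance of `…/TorusLinearisedNSGevrey{Lattice,Balance}.lean`; the LINEAR twin of the
Foias–Temam Gevrey-class estimate, J. Funct. Anal. 87 (1989), Thm 1.1 / Lemma 2.1, run with truncated Gevrey
weights on the lattice `ℤ³`), read against the line's predicate `IsLinearizedNSSolutionOn S ν u w q` (file
`…ErgodicLine.lean`: `w, q` jointly smooth, `div w(t) = 0`, `∫ w(t) = 0`, `∂ₜw + (u·∇)w + (w·∇)u = νΔw − ∇q`):
along a jointly smooth divergence-free background `u` on `[a, a + τ] × T³` which is uniformly Gevrey,
`∑_{k ∈ S'} e^{2σ₀|k|} ‖û(t, k)‖² ≤ C₀`, every linearised solution satisfies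
`∑_{k ∈ S'} e^{2σ|k|} ‖ŵ(a + τ, k)‖² ≤ C (‖w(a)‖₂² + ‖∇w(a)‖₂²)` with `σ > 0`, `C` depending only on
`(ν, σ₀, C₀, τ)` — the derivative cocycle along a uniformly Gevrey trajectory maps `H¹`-bounded data into a
Gevrey-bounded (hence every-`H^k`-bounded) set at each positive time, uniformly along the tube (block N-R of the
smooth-model construction).  The registered tools stub `stub_linearisedGevreySmoothingTools` is proved BY NAME with
exactly the registered signature.

Reference: C. Foias, R. Temam, *Gevrey class regularity for the solutions of the Navier–Stokes equations*,
J. Funct. Anal. 87 (1989) 359–369, Thm 1.1, Lemma 2.1.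
-/

-- `Summit.<Summit>.<Problem>` is the tree's mandated summit-side namespace (CONVENTIONS §2); for this
-- single-conjunct summit the two coincide, so the duplicate is deliberate.
set_option linter.dupNamespace false

noncomputable section

open scoped BigOperators Topology ENNReal InnerProductSpace
open Filter Set Function MeasureTheory

namespace Summit.AnomalousDissipation.AnomalousDissipation.Theorems.DenseLoudDesignerForces.Ergodic

open Literature.Analysis.FunctionSpaces Literature.Analysis.FunctionSpaces.Torus
open Literature.Analysis.FluidPDE Literature.Analysis.FluidPDE.Torus

/-- **Tools stub T1g of block N-R (`stub_linearisedGevreySmoothingTools`, crux stmt-AnomalousDissipation-1143, line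
`ergodic-budget-selection-closing`) — the linearised flow is Gevrey-smoothing along a Gevrey background.**  For `ν > 0`,
a Gevrey radius `σ₀ > 0` and level `C₀` of the background and a time lapse `τ > 0` there are `σ > 0` and `C` such that:
along every jointly smooth divergence-free background `u` on `[a, a + τ] × T³` with
`∑_{k ∈ S'} e^{2σ₀|k|} ‖û(t, k)‖² ≤ C₀` for all `t` and all finite `S'`, every solution `(w, q)` of the linearised system
(`IsLinearizedNSSolutionOn`: smooth, divergence free, mean zero) satisfies
`∑_{k ∈ S'} e^{2σ|k|} ‖ŵ(a + τ, k)‖² ≤ C (∫ ‖w(a)‖² + ‖∇w(a)‖₂²)` for every finite `S'` — the linear Gevrey balance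
`Y_R' ≤ −(5/4)κ Z_R + K Y` (both bilinear terms `≤ K √Y √Z_R` by the submultiplicativity of the truncated weights), its
two-level time integration, a bootstrap at the levels `2y₀ + ε` and the exponential `H¹` bound of the linearised flow
(`Torus.linearisedNS_gevrey_of_gevreyBound` at `d = Fin 3`, the conjunction `IsLinearizedNSSolutionOn` unpacked).
[cite: FoiasTemam1989, Thm 1.1 and Lemma 2.1] -/
theorem stub_linearisedGevreySmoothingTools {ν : ℝ} (hν : 0 < ν) (σ₀ C₀ τ : ℝ) (hσ₀ : 0 < σ₀) (hτ : 0 < τ) :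
    ∃ σ : ℝ, 0 < σ ∧ ∃ C : ℝ, ∀ {a : ℝ} {u w : ℝ → (UnitAddTorus (Fin 3)) → (EuclideanSpace ℝ (Fin 3))} {q : ℝ → (UnitAddTorus (Fin 3)) → ℝ},
      IsSmoothSpaceTimeOn (Icc a (a + τ)) u → (∀ t ∈ Icc a (a + τ), IsDivFree (u t)) →
      (∀ t ∈ Icc a (a + τ), ∀ S' : Finset (Fin 3 → ℤ), ∑ k ∈ S', Real.exp (2 * σ₀ * Real.sqrt (freqNormSq k)) *
        ‖UnitAddTorus.mFourierCoeff (EuclideanSpace.complexify ∘ u t) k‖ ^ 2 ≤ C₀) →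
      IsLinearizedNSSolutionOn (Icc a (a + τ)) ν u w q →
      ∀ S' : Finset (Fin 3 → ℤ), ∑ k ∈ S', Real.exp (2 * σ * Real.sqrt (freqNormSq k)) *
        ‖UnitAddTorus.mFourierCoeff (EuclideanSpace.complexify ∘ w (a + τ)) k‖ ^ 2 ≤
          C * ((∫ x, ‖w a x‖ ^ 2) + gradNormSq (w a)) := by
  obtain ⟨σ, hσ, C, hC⟩ := linearisedNS_gevrey_of_gevreyBound (d := Fin 3) hν σ₀ C₀ τ hσ₀ hτ
  exact ⟨σ, hσ, C, fun hu hudiv hgev h => hC hu hudiv hgev h.1 h.2.1 h.2.2.1 h.2.2.2.1 h.2.2.2.2⟩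

end Summit.AnomalousDissipation.AnomalousDissipation.Theorems.DenseLoudDesignerForces.Ergodic

end
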